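import Literature.NumberTheory.LFunctions.PartialEulerProductsProofs
import Mathlib.NumberTheory.Chebyshev
import Mathlib.Analysis.PSeries
import Mathlib.Analysis.Normed.Group.Tannery
import HarnessLib

/-!
# Partial Euler products: proof of Conrad's Lemma 3.1 (double sum versus single sum)

Sibling proof file of `Literature.NumberTheory.LFunctions.PartialEulerProducts` discharging the
named fact `Literature.NumberTheory.LFunctions.PartialEuler.Conrad2005_lemma_3_1` (K. Conrad, *Partial Euler products on the
critical line*, Canad. J. Math. **57** (2005), Lemma 3.1, pp. 271–272): for a normalized datum
`α` of degree `≤ d` and `Re s ≥ 1/2`,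
`∑_{p ≤ x} ∑_{k ≥ 1} (α_{p,1}^k + ⋯ + α_{p,d}^k)/(k p^{ks})
  = ∑_{p^k ≤ x} (α_{p,1}^k + ⋯ + α_{p,d}^k)/(k p^{ks}) + ∑_{√x < p ≤ x} (α_{p,1}² + ⋯ + α_{p,d}²)/(2p^{2s}) + o(1)`,
and for `Re s > 1/2` the middle sum is `o(1)`.

The printed proof, written out (with `t_p(k) = (∑_j α_{p,j}^k) p^{-ks}/k`, `|t_p(k)| ≤ d p^{-k/2}/k`,
`K_p = ⌊log_p ⌊x⌋⌋`): the difference "double minus single" is `∑_{p ≤ x} ∑_{k > K_p} t_p(k)`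
(after re-indexing the single sum over the prime powers by `(p, k)`, `logPartialSum_natCast_eq_sum_sum`).
For `√x < p ≤ x` one has `K_p = 1` and the tail is `t_p(2) + ∑_{k ≥ 3} t_p(k)` with
`|∑_{k ≥ 3} t_p(k)| ≤ (4/3) d p^{-3/2}`, whose sum over `p > √x` is a tail of a convergent series;
for `p ≤ √x` one has `p^{K_p + 1} > ⌊x⌋`, so the tail is at most
`4d p^{-(K_p+1)/2}/(K_p+1) ≤ 4d ⌊x⌋^{-1/2} log p / log ⌊x⌋`, and summing over `p ≤ √x` with
Chebyshev's `θ(y) ≤ y log 4` (Mathlib's `Chebyshev.theta_le_log4_mul_x`) gives `≤ 4d log 4/log ⌊x⌋`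
(Conrad: "`O(π_K(√x)/√x) = O(1/log x)`"). Finally `|t_p(2)| ≤ d p^{-2σ}` and `∑_{p > √x} p^{-2σ} → 0`
when `σ > 1/2`. No definitions are introduced.

## References

* K. Conrad, *Partial Euler products on the critical line*, Canad. J. Math. 57 (2005) 267–297,
  Lemma 3.1 and its proof ((3.2)). [cite: Conrad2005PartialEuler]
-/

noncomputable section

open scoped Topology
open Filter Finset Complex

namespace Literature.NumberTheory.LFunctions

namespace PartialEuler

variable {d : ℕ} {α : ℕ → Fin d → ℂ}

/-! ### The terms `t_p(k) = (∑_j (α_{p,j} p^{-s})^k)/k` and their tails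

In the docstrings `q = p^{-Re s}`; for `Re s ≥ 1/2`, `q ≤ p^{-1/2} ≤ 3/4`. -/

/-- `‖∑_j (α_{p,j} p^{-s})^k‖ ≤ d q^k`. [folklore] -/
theorem norm_sum_mul_cpow_pow_le (hα : IsNormalized α) {p : ℕ} (hp : p.Prime) (s : ℂ) (k : ℕ) :
    ‖∑ j, (α p j * (p : ℂ) ^ (-s)) ^ k‖ ≤ d * ((p : ℝ) ^ (-s.re)) ^ k := by
  refine (norm_sum_le _ _).trans ?_
  calc ∑ j, ‖(α p j * (p : ℂ) ^ (-s)) ^ k‖ ≤ ∑ _j : Fin d, ((p : ℝ) ^ (-s.re)) ^ k := by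
        refine Finset.sum_le_sum fun j _ => ?_
        rw [norm_pow]
        exact pow_le_pow_left₀ (norm_nonneg _) (norm_mul_cpow_neg_le hα hp j s) k
    _ = d * ((p : ℝ) ^ (-s.re)) ^ k := by
        rw [Finset.sum_const, Finset.card_univ, Fintype.card_fin, nsmul_eq_mul]

/-- `‖t_p(k)‖ ≤ d q^k / K` for `k ≥ K ≥ 1`. [folklore] -/
theorem norm_term_le_div (hα : IsNormalized α) {p : ℕ} (hp : p.Prime) (s : ℂ) {K k : ℕ}
    (hK : K ≠ 0) (hk : K ≤ k) :
    ‖(∑ j, (α p j * (p : ℂ) ^ (-s)) ^ k) / k‖ ≤ d * ((p : ℝ) ^ (-s.re)) ^ k / K := by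
  rw [norm_div, Complex.norm_natCast]
  exact div_le_div₀ (by positivity) (norm_sum_mul_cpow_pow_le hα hp s k)
    (by exact_mod_cast Nat.pos_of_ne_zero hK) (by exact_mod_cast hk)

/-- `‖t_p(k)‖ ≤ d q^k` for all `k`. [folklore] -/
theorem norm_term_le (hα : IsNormalized α) {p : ℕ} (hp : p.Prime) (s : ℂ) (k : ℕ) :
    ‖(∑ j, (α p j * (p : ℂ) ^ (-s)) ^ k) / k‖ ≤ d * ((p : ℝ) ^ (-s.re)) ^ k := by
  rcases Nat.eq_zero_or_pos k with rfl | hk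
  · simp
  refine (norm_term_le_div hα hp s (K := 1) one_ne_zero hk).trans ?_
  rw [Nat.cast_one, div_one]

/-- `q = p^{-Re s} ≤ 3/4` for `Re s ≥ 1/2`. [folklore] -/
theorem rpow_neg_re_le_three_fourths {p : ℕ} (hp : p.Prime) {s : ℂ} (hs : 1 / 2 ≤ s.re) :
    (p : ℝ) ^ (-s.re) ≤ 3 / 4 :=
  (Real.rpow_le_rpow_of_exponent_le (by exact_mod_cast hp.one_lt.le) (by linarith)).trans
    (prime_rpow_neg_half_le hp)

/-- The `k`-series of one Euler factor is summable (`Re s > 0`). [folklore] -/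
theorem summable_term (hα : IsNormalized α) {p : ℕ} (hp : p.Prime) {s : ℂ} (hs : 0 < s.re) :
    Summable fun k : ℕ => (∑ j, (α p j * (p : ℂ) ^ (-s)) ^ k) / k :=
  (logEulerFactor_eq_tsum hα hp hs).summable

/-- **Tail bound:** `‖∑_{k ≥ K+1} t_p(k)‖ ≤ 4 d q^{K+1}/(K+1)` for `Re s ≥ 1/2`
(termwise `d q^k/(K+1)`, geometric series, `1/(1-q) ≤ 4`). [folklore] -/
theorem norm_tsum_tail_le (hα : IsNormalized α) {p : ℕ} (hp : p.Prime) {s : ℂ} (hs : 1 / 2 ≤ s.re)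
    (K : ℕ) :
    ‖∑' k, (∑ j, (α p j * (p : ℂ) ^ (-s)) ^ (k + (K + 1))) / (k + (K + 1) : ℕ)‖ ≤
      4 * d * ((p : ℝ) ^ (-s.re)) ^ (K + 1) / (K + 1) := by
  set q : ℝ := (p : ℝ) ^ (-s.re) with hq
  have hq0 : 0 ≤ q := by positivity
  have hq1 : q ≤ 3 / 4 := rpow_neg_re_le_three_fourths hp hs
  set C : ℝ := d * q ^ (K + 1) / (K + 1) with hC
  have hC0 : 0 ≤ C := by positivity
  have hgeom : HasSum (fun k : ℕ => C * q ^ k) (C * (1 - q)⁻¹) :=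
    (hasSum_geometric_of_lt_one hq0 (by linarith)).mul_left C
  have hbd := tsum_of_norm_bounded hgeom (f := fun k : ℕ =>
      (∑ j, (α p j * (p : ℂ) ^ (-s)) ^ (k + (K + 1))) / (k + (K + 1) : ℕ)) fun k => by
    have := norm_term_le_div hα hp s (K := K + 1) (k := k + (K + 1)) (by omega) (by omega)
    refine this.trans (le_of_eq ?_)
    simp only [hC]
    push_cast
    ring
  refine hbd.trans ?_
  have hinv : (1 - q)⁻¹ ≤ 4 := by
    have := inv_anti₀ (show (0 : ℝ) < 1 / 4 by norm_num) (show 1 / 4 ≤ 1 - q by linarith)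
    norm_num at this
    exact this
  calc C * (1 - q)⁻¹ ≤ C * 4 := by gcongr
    _ = 4 * d * q ^ (K + 1) / (K + 1) := by simp only [hC]; ring

/-- **The factor is the finite sum plus the tail:** `c_p(s) = ∑_{k ≤ K} t_p(k) + ∑_{k ≥ K+1} t_p(k)`
(`Re s > 0`). [folklore] -/
theorem logEulerFactor_eq_sum_add_tsum (hα : IsNormalized α) {p : ℕ} (hp : p.Prime) {s : ℂ}
    (hs : 0 < s.re) (K : ℕ) :
    logEulerFactor α s p = ∑ k ∈ Finset.range (K + 1), (∑ j, (α p j * (p : ℂ) ^ (-s)) ^ k) / k +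
      ∑' k, (∑ j, (α p j * (p : ℂ) ^ (-s)) ^ (k + (K + 1))) / (k + (K + 1) : ℕ) := by
  rw [← (logEulerFactor_eq_tsum hα hp hs).tsum_eq]
  exact ((summable_term hα hp hs).sum_add_tsum_nat_add (K + 1)).symm

/-! ### The single sum re-indexed over `(p, k)` -/

/-- The summand of the single sum at a prime power: `b_{p^k} (p^k)^{-s} = t_p(k)`. [folklore] -/
theorem logCoeff_mul_cpow_prime_pow (α : ℕ → Fin d → ℂ) {p k : ℕ} (hp : p.Prime) (hk : k ≠ 0)
    (s : ℂ) : logCoeff α (p ^ k) * ((p ^ k : ℕ) : ℂ) ^ (-s) =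
      (∑ j, (α p j * (p : ℂ) ^ (-s)) ^ k) / k := by
  rw [logCoeff_prime_pow α hp hk, Nat.cast_pow, ← natCast_cpow_natCast_mul, cpow_nat_mul]
  simp_rw [mul_pow]
  rw [← Finset.sum_mul]
  ring

/-- **Re-indexing the single sum:** at a natural number `N`,
`∑_{n ≤ N} b_n n^{-s} = ∑_{p ≤ N} ∑_{k ≤ log_p N} t_p(k)` (the term `k = 0` is `0`). [folklore] -/
theorem logPartialSum_natCast_eq_sum_sum (α : ℕ → Fin d → ℂ) (s : ℂ) (N : ℕ) :
    logPartialSum α s N = ∑ p ∈ Nat.primesLE N, ∑ k ∈ Finset.range (Nat.log p N + 1),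
      (∑ j, (α p j * (p : ℂ) ^ (-s)) ^ k) / k := by
  classical
  rw [logPartialSum, Nat.floor_natCast]
  -- restrict to prime powers
  have h1 : ∑ n ∈ Finset.Iic N, logCoeff α n * (n : ℂ) ^ (-s) =
      ∑ n ∈ (Finset.Iic N).filter IsPrimePow, logCoeff α n * (n : ℂ) ^ (-s) := by
    rw [Finset.sum_filter]
    refine Finset.sum_congr rfl fun n _ => ?_
    by_cases hn : IsPrimePow n
    · rw [if_pos hn]
    · rw [if_neg hn, logCoeff_of_not_isPrimePow α hn, zero_mul]
  rw [h1]
  -- the inner sums over `range (log p N + 1)` as sums over `Ioc 0 (log p N)`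
  have h2 : ∀ p ∈ Nat.primesLE N, ∑ k ∈ Finset.range (Nat.log p N + 1),
      (∑ j, (α p j * (p : ℂ) ^ (-s)) ^ k) / k =
      ∑ k ∈ Finset.Ioc 0 (Nat.log p N), (∑ j, (α p j * (p : ℂ) ^ (-s)) ^ k) / k := by
    intro p _
    rw [Finset.range_eq_Ico, show Finset.Ico 0 (Nat.log p N + 1) = Finset.Icc 0 (Nat.log p N) from
      rfl, Finset.Icc_eq_cons_Ioc (Nat.zero_le _), Finset.sum_cons]
    simp
  rw [Finset.sum_congr rfl h2, Finset.sum_sigma']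
  -- the bijection `(p, k) ↦ p^k`
  symm
  refine Finset.sum_bij (fun x _ => x.1 ^ x.2) ?_ ?_ ?_ ?_
  · rintro ⟨p, k⟩ hx
    simp only [Finset.mem_sigma, Nat.mem_primesLE, Finset.mem_Ioc] at hx
    obtain ⟨⟨hpN, hp⟩, hk0, hk⟩ := hx
    simp only [Finset.mem_filter, Finset.mem_Iic]
    have hN0 : N ≠ 0 := by have := hp.two_le; omega
    refine ⟨(Nat.pow_le_pow_right hp.pos hk).trans (Nat.pow_log_le_self p hN0), ?_⟩
    exact (hp.prime.isPrimePow).pow (Nat.pos_iff_ne_zero.mp hk0)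
  · rintro ⟨p₁, k₁⟩ hx₁ ⟨p₂, k₂⟩ hx₂ h
    simp only [Finset.mem_sigma, Nat.mem_primesLE, Finset.mem_Ioc] at hx₁ hx₂
    simp only at h
    obtain ⟨hp, hk⟩ := Nat.Prime.pow_inj' hx₁.1.2 hx₂.1.2 (Nat.pos_iff_ne_zero.mp hx₁.2.1)
      (Nat.pos_iff_ne_zero.mp hx₂.2.1) h
    subst hp; subst hk; rfl
  · intro n hn
    simp only [Finset.mem_filter, Finset.mem_Iic] at hn
    obtain ⟨hnN, hpp⟩ := hn
    obtain ⟨p, k, hp, hk, rfl⟩ := (isPrimePow_nat_iff _).mp hpp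
    refine ⟨⟨p, k⟩, ?_, rfl⟩
    simp only [Finset.mem_sigma, Nat.mem_primesLE, Finset.mem_Ioc]
    have hpn : p ≤ p ^ k := by
      calc p = p ^ 1 := (pow_one p).symm
        _ ≤ p ^ k := Nat.pow_le_pow_right hp.pos hk
    exact ⟨⟨hpn.trans hnN, hp⟩, hk, Nat.le_log_of_pow_le hp.one_lt hnN⟩
  · rintro ⟨p, k⟩ hx
    simp only [Finset.mem_sigma, Nat.mem_primesLE, Finset.mem_Ioc] at hx
    exact (logCoeff_mul_cpow_prime_pow α hx.1.2 (Nat.pos_iff_ne_zero.mp hx.2.1) s).symm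

/-- **Double minus single is the sum of the tails:** at a natural number `N` and for `Re s > 0`,
`∑_{p ≤ N} c_p(s) - ∑_{n ≤ N} b_n n^{-s} = ∑_{p ≤ N} ∑_{k > log_p N} t_p(k)`
(Conrad, (3.2)). [cite: Conrad2005PartialEuler, §3 (3.2)] -/
theorem logPartialProduct_sub_logPartialSum_natCast (hα : IsNormalized α) {s : ℂ} (hs : 0 < s.re)
    (N : ℕ) : logPartialProduct α s N - logPartialSum α s N =
      ∑ p ∈ Nat.primesLE N, ∑' k, (∑ j, (α p j * (p : ℂ) ^ (-s)) ^ (k + (Nat.log p N + 1))) /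
        (k + (Nat.log p N + 1) : ℕ) := by
  rw [logPartialProduct, Nat.floor_natCast, logPartialSum_natCast_eq_sum_sum, ← Finset.sum_sub_distrib]
  refine Finset.sum_congr rfl fun p hp => ?_
  rw [logEulerFactor_eq_sum_add_tsum hα (Nat.prime_of_mem_primesLE hp) hs (Nat.log p N)]
  ring

/-! ### The range conditions -/

/-- For a prime `p ≤ ⌊x⌋` (`x ≥ 0`): `√x < p ↔ ⌊x⌋ < p²`. [folklore] -/
theorem sqrt_lt_iff_floor_lt_sq {x : ℝ} (hx : 0 ≤ x) {p : ℕ} :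
    Real.sqrt x < p ↔ ⌊x⌋₊ < p ^ 2 := by
  constructor
  · intro h
    have hp0 : (0 : ℝ) ≤ p := Nat.cast_nonneg p
    have h2 : x < (p : ℝ) ^ 2 := by
      rw [← Real.sqrt_lt' (lt_of_le_of_lt (Real.sqrt_nonneg x) h)] at *
      · nlinarith [Real.sq_sqrt hx, Real.sqrt_nonneg x]
    have : (⌊x⌋₊ : ℝ) < (p : ℝ) ^ 2 := lt_of_le_of_lt (Nat.floor_le hx) h2
    exact_mod_cast this
  · intro h
    have h1 : x < ⌊x⌋₊ + 1 := Nat.lt_floor_add_one x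
    have h2 : (⌊x⌋₊ : ℝ) + 1 ≤ (p : ℝ) ^ 2 := by exact_mod_cast h
    rw [show (p : ℝ) = Real.sqrt ((p : ℝ) ^ 2) by rw [Real.sqrt_sq (Nat.cast_nonneg p)]]
    exact Real.sqrt_lt_sqrt hx (by linarith)

/-- For a prime `p ≤ N`: `N < p²` iff `log_p N = 1`, and `p² ≤ N` iff `2 ≤ log_p N`. [folklore] -/
theorem log_eq_one_of_lt_sq {p N : ℕ} (hp : p.Prime) (hpN : p ≤ N) (h : N < p ^ 2) : Nat.log p N = 1 :=
  Nat.log_eq_one_iff.mpr ⟨by rwa [← pow_two], hp.one_lt, hpN⟩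

/-- (see `log_eq_one_of_lt_sq`) [folklore] -/
theorem two_le_log_of_sq_le {p N : ℕ} (hp : p.Prime) (h : p ^ 2 ≤ N) : 2 ≤ Nat.log p N :=
  Nat.le_log_of_pow_le hp.one_lt h

/-! ### Tails of `∑_p p^{-a}` over `p > √N` -/

/-- For `a > 1`: `∑_{p prime, p² > N} p^{-a} → 0` as `N → ∞` (a tail of a convergent series;
dominated convergence). [folklore] -/
theorem tendsto_tsum_primes_sq_gt (a : ℝ) (ha : 1 < a) :
    Tendsto (fun N : ℕ => ∑' n : ℕ, if n.Prime ∧ N < n ^ 2 then (n : ℝ) ^ (-a) else 0) atTop (𝓝 0) := by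
  have hsum : Summable fun n : ℕ => (n : ℝ) ^ (-a) := Real.summable_nat_rpow.mpr (by linarith)
  have key : Tendsto (fun N : ℕ => ∑' n : ℕ, if n.Prime ∧ N < n ^ 2 then (n : ℝ) ^ (-a) else 0) atTop
      (𝓝 (∑' _ : ℕ, (0 : ℝ))) := by
    refine tendsto_tsum_of_dominated_convergence hsum (fun n => ?_) (Eventually.of_forall fun N n => ?_)
    · refine tendsto_const_nhds.congr' ?_
      filter_upwards [eventually_ge_atTop (n ^ 2)] with N hN
      exact (if_neg (fun h => absurd h.2 (not_lt.mpr hN))).symm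
    · split_ifs
      · rw [Real.norm_of_nonneg (by positivity)]
      · rw [norm_zero]; positivity
  rwa [tsum_zero] at key

/-- The finite sum over the primes `p ≤ N` with `p² > N` of `p^{-a}` is at most the full tail.
[folklore] -/
theorem sum_filter_rpow_le_tsum {a : ℝ} (ha : 1 < a) (N : ℕ) :
    ∑ p ∈ (Nat.primesLE N).filter (fun p => N < p ^ 2), (p : ℝ) ^ (-a) ≤
      ∑' n : ℕ, if n.Prime ∧ N < n ^ 2 then (n : ℝ) ^ (-a) else 0 := by
  have hsum : Summable fun n : ℕ => if n.Prime ∧ N < n ^ 2 then (n : ℝ) ^ (-a) else 0 := by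
    refine Summable.of_nonneg_of_le (fun n => ?_) (fun n => ?_) (Real.summable_nat_rpow.mpr (by linarith : -a < -1))
    · split_ifs <;> positivity
    · split_ifs
      · exact le_rfl
      · positivity
  calc ∑ p ∈ (Nat.primesLE N).filter (fun p => N < p ^ 2), (p : ℝ) ^ (-a)
      = ∑ p ∈ (Nat.primesLE N).filter (fun p => N < p ^ 2),
          (if p.Prime ∧ N < p ^ 2 then (p : ℝ) ^ (-a) else 0) := by
        refine Finset.sum_congr rfl fun p hp => ?_
        rw [Finset.mem_filter, Nat.mem_primesLE] at hp
        rw [if_pos ⟨hp.1.2, hp.2⟩]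
    _ ≤ _ := hsum.sum_le_tsum _ fun n _ => by split_ifs <;> positivity

/-! ### Chebyshev: `∑_{p ≤ √N} log p ≤ log 4 · √N` -/

/-- `∑_{p ≤ N, p² ≤ N} log p = θ(⌊√N⌋) ≤ log 4 · √N`. [folklore] -/
theorem sum_log_le_of_sq_le (N : ℕ) :
    ∑ p ∈ (Nat.primesLE N).filter (fun p => ¬ N < p ^ 2), Real.log p ≤ Real.log 4 * Real.sqrt N := by
  have hset : (Nat.primesLE N).filter (fun p => ¬ N < p ^ 2) = Nat.primesLE (Nat.sqrt N) := by
    ext p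
    simp only [Finset.mem_filter, Nat.mem_primesLE, not_lt, Nat.le_sqrt']
    constructor
    · rintro ⟨⟨-, hp⟩, h⟩; exact ⟨h, hp⟩
    · rintro ⟨h, hp⟩
      have hp2 : p ≤ p ^ 2 := by rw [sq]; exact Nat.le_mul_self p
      exact ⟨⟨hp2.trans h, hp⟩, h⟩
  rw [hset, ← Chebyshev.theta_eq_sum_primesLE_log]
  refine (Chebyshev.theta_le_log4_mul_x (Nat.cast_nonneg _)).trans ?_
  exact mul_le_mul_of_nonneg_left (Real.le_sqrt_of_sq_le (by exact_mod_cast Nat.sqrt_le' N))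
    (Real.log_nonneg (by norm_num))

/-! ### The middle summand and the decomposition at a natural number -/

/-- `t_p(2) = (∑_j α_{p,j}²)/(2 p^{2s})`. [folklore] -/
theorem term_two_eq (α : ℕ → Fin d → ℂ) {p : ℕ} (hp : p.Prime) (s : ℂ) :
    (∑ j, (α p j * (p : ℂ) ^ (-s)) ^ 2) / (2 : ℕ) = (∑ j, α p j ^ 2) / (2 * (p : ℂ) ^ (2 * s)) := by
  have hp0 : (p : ℂ) ≠ 0 := Nat.cast_ne_zero.mpr hp.ne_zero
  simp_rw [mul_pow]
  rw [← Finset.sum_mul, ← cpow_nat_mul, show ((2 : ℕ) : ℂ) * -s = -(2 * s) by push_cast; ring, cpow_neg]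
  push_cast
  field_simp

/-- **The decomposition** (Conrad (3.2), split at `√x`): at a natural number `N`, for `Re s > 0`,
`(double - single)(N) - ∑_{p ≤ N, N < p²} t_p(2)
  = ∑_{p ≤ N, p² ≤ N} ∑_{k ≥ log_p N + 1} t_p(k) + ∑_{p ≤ N, N < p²} ∑_{k ≥ 3} t_p(k)`.
[cite: Conrad2005PartialEuler, §3 (3.2)] -/
theorem sub_single_sub_middle_natCast (hα : IsNormalized α) {s : ℂ} (hs : 0 < s.re) (N : ℕ) :
    logPartialProduct α s N - logPartialSum α s N -
        ∑ p ∈ (Nat.primesLE N).filter (fun p => N < p ^ 2), (∑ j, (α p j * (p : ℂ) ^ (-s)) ^ 2) / (2 : ℕ) =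
      ∑ p ∈ (Nat.primesLE N).filter (fun p => ¬ N < p ^ 2),
          ∑' k, (∑ j, (α p j * (p : ℂ) ^ (-s)) ^ (k + (Nat.log p N + 1))) / (k + (Nat.log p N + 1) : ℕ) +
      ∑ p ∈ (Nat.primesLE N).filter (fun p => N < p ^ 2),
          ∑' k, (∑ j, (α p j * (p : ℂ) ^ (-s)) ^ (k + 3)) / (k + 3 : ℕ) := by
  rw [logPartialProduct_sub_logPartialSum_natCast hα hs N,
    ← Finset.sum_filter_add_sum_filter_not (Nat.primesLE N) (fun p => N < p ^ 2)]
  -- on `N < p²` the tail starts at `k = 2`: split off `t_p(2)`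
  have htail2 : ∀ p ∈ (Nat.primesLE N).filter (fun p => N < p ^ 2),
      ∑' k, (∑ j, (α p j * (p : ℂ) ^ (-s)) ^ (k + (Nat.log p N + 1))) / (k + (Nat.log p N + 1) : ℕ) =
      (∑ j, (α p j * (p : ℂ) ^ (-s)) ^ 2) / (2 : ℕ) +
        ∑' k, (∑ j, (α p j * (p : ℂ) ^ (-s)) ^ (k + 3)) / (k + 3 : ℕ) := by
    intro p hp
    rw [Finset.mem_filter, Nat.mem_primesLE] at hp
    have hlog : Nat.log p N = 1 := log_eq_one_of_lt_sq hp.1.2 hp.1.1 hp.2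
    -- the shifted sequence `f k = t_p(k + 2)`
    set f : ℕ → ℂ := fun k => (∑ j, (α p j * (p : ℂ) ^ (-s)) ^ (k + 2)) / (k + 2 : ℕ) with hf
    have hsumf : Summable f := (summable_nat_add_iff 2).mpr (summable_term hα hp.1.2 hs)
    have hlhs : (fun k : ℕ => (∑ j, (α p j * (p : ℂ) ^ (-s)) ^ (k + (Nat.log p N + 1))) /
        (k + (Nat.log p N + 1) : ℕ)) = f := by
      funext k
      simp only [hf, hlog]
    have hrhs : (fun k : ℕ => (∑ j, (α p j * (p : ℂ) ^ (-s)) ^ (k + 3)) / (k + 3 : ℕ)) = fun k => f (k + 1) := by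
      funext k
      simp only [hf, add_assoc]
    have h0 : f 0 = (∑ j, (α p j * (p : ℂ) ^ (-s)) ^ 2) / (2 : ℕ) := by
      simp only [hf, zero_add]
    rw [hlhs, hrhs, hsumf.tsum_eq_zero_add, h0]
  rw [Finset.sum_congr rfl htail2, Finset.sum_add_distrib]
  ring

/-- **Bound for the `k ≥ 3` tails:** `‖∑_{k ≥ 3} t_p(k)‖ ≤ 2 d p^{-3/2}` for `Re s ≥ 1/2`. [folklore] -/
theorem norm_tail_three_le (hα : IsNormalized α) {p : ℕ} (hp : p.Prime) {s : ℂ} (hs : 1 / 2 ≤ s.re) :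
    ‖∑' k, (∑ j, (α p j * (p : ℂ) ^ (-s)) ^ (k + 3)) / (k + 3 : ℕ)‖ ≤ 2 * d * (p : ℝ) ^ (-(3 / 2 : ℝ)) := by
  refine (norm_tsum_tail_le hα hp hs 2).trans ?_
  have hq : ((p : ℝ) ^ (-s.re)) ^ (2 + 1) ≤ (p : ℝ) ^ (-(3 / 2 : ℝ)) := by
    have hp1 : (1 : ℝ) ≤ p := by exact_mod_cast hp.one_lt.le
    rw [← Real.rpow_natCast, ← Real.rpow_mul (by positivity)]
    exact Real.rpow_le_rpow_of_exponent_le hp1 (by push_cast; nlinarith)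
  have hd : (0 : ℝ) ≤ d := Nat.cast_nonneg d
  calc 4 * d * ((p : ℝ) ^ (-s.re)) ^ (2 + 1) / (2 + 1) ≤ 4 * d * (p : ℝ) ^ (-(3 / 2 : ℝ)) / (2 + 1) := by
        gcongr
    _ ≤ 2 * d * (p : ℝ) ^ (-(3 / 2 : ℝ)) := by
        have : 0 ≤ (d : ℝ) * (p : ℝ) ^ (-(3 / 2 : ℝ)) := by positivity
        nlinarith

/-- **Bound for the tails over `p² ≤ N`:** for `N ≥ 2`, a prime `p ≤ N` with `p² ≤ N`, and
`Re s ≥ 1/2`, `‖∑_{k > log_p N} t_p(k)‖ ≤ 4 d N^{-1/2} log p / log N` (since `p^{log_p N + 1} > N`).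
[cite: Conrad2005PartialEuler, proof of Lemma 3.1] -/
theorem norm_tail_log_le (hα : IsNormalized α) {s : ℂ} (hs : 1 / 2 ≤ s.re) {N : ℕ} (hN : 2 ≤ N)
    {p : ℕ} (hp : p.Prime) :
    ‖∑' k, (∑ j, (α p j * (p : ℂ) ^ (-s)) ^ (k + (Nat.log p N + 1))) / (k + (Nat.log p N + 1) : ℕ)‖ ≤
      4 * d * ((N : ℝ) ^ (-(1 / 2 : ℝ)) * (Real.log p / Real.log N)) := by
  set K := Nat.log p N with hK
  have hNpos : (0 : ℝ) < N := by exact_mod_cast (by omega : 0 < N)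
  have hlogN : 0 < Real.log N := Real.log_pos (by exact_mod_cast (by omega : 1 < N))
  have hp1 : (1 : ℝ) < p := by exact_mod_cast hp.one_lt
  have hNlt : N < p ^ (K + 1) := Nat.lt_pow_succ_log_self hp.one_lt N
  have hNlt' : (N : ℝ) < (p : ℝ) ^ (K + 1) := by exact_mod_cast hNlt
  refine (norm_tsum_tail_le hα hp hs K).trans ?_
  -- `q^{K+1} ≤ (p^{K+1})^{-1/2} ≤ N^{-1/2}`
  have hq : ((p : ℝ) ^ (-s.re)) ^ (K + 1) ≤ (N : ℝ) ^ (-(1 / 2 : ℝ)) := by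
    have hbase : (p : ℝ) ^ (-s.re) ≤ (p : ℝ) ^ (-(1 / 2 : ℝ)) :=
      Real.rpow_le_rpow_of_exponent_le hp1.le (by linarith)
    calc ((p : ℝ) ^ (-s.re)) ^ (K + 1) ≤ ((p : ℝ) ^ (-(1 / 2 : ℝ))) ^ (K + 1) :=
          pow_le_pow_left₀ (by positivity) hbase (K + 1)
      _ = ((p : ℝ) ^ (K + 1 : ℕ) : ℝ) ^ (-(1 / 2 : ℝ)) := by
          rw [← Real.rpow_natCast ((p : ℝ) ^ (-(1 / 2 : ℝ))), ← Real.rpow_mul (by positivity),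
            ← Real.rpow_natCast (p : ℝ), ← Real.rpow_mul (by positivity), mul_comm]
      _ ≤ (N : ℝ) ^ (-(1 / 2 : ℝ)) :=
          Real.rpow_le_rpow_of_nonpos hNpos hNlt'.le (by norm_num)
  -- `1/(K+1) ≤ log p / log N`
  have hKlog : (1 : ℝ) / (K + 1) ≤ Real.log p / Real.log N := by
    rw [div_le_div_iff₀ (by positivity) hlogN, one_mul]
    have := Real.log_lt_log hNpos hNlt'
    rw [Real.log_pow] at this
    push_cast at this
    linarith
  have hd : (0 : ℝ) ≤ d := Nat.cast_nonneg d
  calc 4 * d * ((p : ℝ) ^ (-s.re)) ^ (K + 1) / (K + 1)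
      = 4 * d * (((p : ℝ) ^ (-s.re)) ^ (K + 1) * (1 / (K + 1))) := by ring
    _ ≤ 4 * d * ((N : ℝ) ^ (-(1 / 2 : ℝ)) * (Real.log p / Real.log N)) := by
        gcongr

/-- **The bound at a natural number:** for `N ≥ 2` and `Re s ≥ 1/2`,
`‖(double - single)(N) - middle(N)‖ ≤ 4d log 4 / log N + 2d ∑_{p prime, p² > N} p^{-3/2}`.
[cite: Conrad2005PartialEuler, proof of Lemma 3.1] -/
theorem norm_sub_single_sub_middle_le (hα : IsNormalized α) {s : ℂ} (hs : 1 / 2 ≤ s.re) {N : ℕ}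
    (hN : 2 ≤ N) :
    ‖logPartialProduct α s N - logPartialSum α s N -
        ∑ p ∈ (Nat.primesLE N).filter (fun p => N < p ^ 2), (∑ j, (α p j * (p : ℂ) ^ (-s)) ^ 2) / (2 : ℕ)‖ ≤
      4 * d * (Real.log 4 / Real.log N) +
        2 * d * ∑' n : ℕ, (if n.Prime ∧ N < n ^ 2 then (n : ℝ) ^ (-(3 / 2 : ℝ)) else 0) := by
  have hs0 : 0 < s.re := by linarith
  have hNpos : (0 : ℝ) < N := by exact_mod_cast (by omega : 0 < N)
  rw [sub_single_sub_middle_natCast hα hs0 N]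
  refine (norm_add_le _ _).trans (add_le_add ?_ ?_)
  · -- R₁
    refine (norm_sum_le _ _).trans ?_
    calc ∑ p ∈ (Nat.primesLE N).filter (fun p => ¬ N < p ^ 2),
          ‖∑' k, (∑ j, (α p j * (p : ℂ) ^ (-s)) ^ (k + (Nat.log p N + 1))) / (k + (Nat.log p N + 1) : ℕ)‖
        ≤ ∑ p ∈ (Nat.primesLE N).filter (fun p => ¬ N < p ^ 2),
            4 * d * ((N : ℝ) ^ (-(1 / 2 : ℝ)) * (Real.log p / Real.log N)) :=
          Finset.sum_le_sum fun p hp =>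
            norm_tail_log_le hα hs hN (Nat.prime_of_mem_primesLE (Finset.mem_filter.mp hp).1)
      _ = 4 * d * ((N : ℝ) ^ (-(1 / 2 : ℝ)) / Real.log N) *
            ∑ p ∈ (Nat.primesLE N).filter (fun p => ¬ N < p ^ 2), Real.log p := by
          rw [Finset.mul_sum]
          refine Finset.sum_congr rfl fun p _ => ?_
          ring
      _ ≤ 4 * d * ((N : ℝ) ^ (-(1 / 2 : ℝ)) / Real.log N) * (Real.log 4 * Real.sqrt N) := by
          have : 0 ≤ 4 * (d : ℝ) * ((N : ℝ) ^ (-(1 / 2 : ℝ)) / Real.log N) := by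
            have : 0 ≤ Real.log N := Real.log_nonneg (by exact_mod_cast (by omega : 1 ≤ N))
            positivity
          exact mul_le_mul_of_nonneg_left (sum_log_le_of_sq_le N) this
      _ = 4 * d * (Real.log 4 / Real.log N) * ((N : ℝ) ^ (-(1 / 2 : ℝ)) * Real.sqrt N) := by ring
      _ = 4 * d * (Real.log 4 / Real.log N) := by
          rw [Real.sqrt_eq_rpow, ← Real.rpow_add hNpos]
          norm_num
  · -- R₃
    refine (norm_sum_le _ _).trans ?_
    calc ∑ p ∈ (Nat.primesLE N).filter (fun p => N < p ^ 2),
          ‖∑' k, (∑ j, (α p j * (p : ℂ) ^ (-s)) ^ (k + 3)) / (k + 3 : ℕ)‖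
        ≤ ∑ p ∈ (Nat.primesLE N).filter (fun p => N < p ^ 2), 2 * d * (p : ℝ) ^ (-(3 / 2 : ℝ)) :=
          Finset.sum_le_sum fun p hp =>
            norm_tail_three_le hα (Nat.prime_of_mem_primesLE (Finset.mem_filter.mp hp).1) hs
      _ = 2 * d * ∑ p ∈ (Nat.primesLE N).filter (fun p => N < p ^ 2), (p : ℝ) ^ (-(3 / 2 : ℝ)) := by
          rw [Finset.mul_sum]
      _ ≤ 2 * d * ∑' n : ℕ, (if n.Prime ∧ N < n ^ 2 then (n : ℝ) ^ (-(3 / 2 : ℝ)) else 0) := by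
          gcongr
          exact sum_filter_rpow_le_tsum (by norm_num) N

/-- **Bound for the middle sum:** `‖∑_{p ≤ N, N < p²} t_p(2)‖ ≤ d ∑_{p prime, p² > N} p^{-2 Re s}`
(`Re s > 1/2`). [folklore] -/
theorem norm_middle_le (hα : IsNormalized α) {s : ℂ} (hs : 1 / 2 < s.re) (N : ℕ) :
    ‖∑ p ∈ (Nat.primesLE N).filter (fun p => N < p ^ 2), (∑ j, (α p j * (p : ℂ) ^ (-s)) ^ 2) / (2 : ℕ)‖ ≤
      d * ∑' n : ℕ, (if n.Prime ∧ N < n ^ 2 then (n : ℝ) ^ (-(2 * s.re)) else 0) := by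
  refine (norm_sum_le _ _).trans ?_
  calc ∑ p ∈ (Nat.primesLE N).filter (fun p => N < p ^ 2), ‖(∑ j, (α p j * (p : ℂ) ^ (-s)) ^ 2) / (2 : ℕ)‖
      ≤ ∑ p ∈ (Nat.primesLE N).filter (fun p => N < p ^ 2), d * (p : ℝ) ^ (-(2 * s.re)) := by
        refine Finset.sum_le_sum fun p hp => ?_
        have hp' := Nat.prime_of_mem_primesLE (Finset.mem_filter.mp hp).1
        refine (norm_term_le hα hp' s 2).trans (le_of_eq ?_)
        congr 1
        rw [← Real.rpow_natCast, ← Real.rpow_mul (Nat.cast_nonneg p)]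
        congr 1
        push_cast
        ring
    _ = d * ∑ p ∈ (Nat.primesLE N).filter (fun p => N < p ^ 2), (p : ℝ) ^ (-(2 * s.re)) := by
        rw [Finset.mul_sum]
    _ ≤ d * ∑' n : ℕ, (if n.Prime ∧ N < n ^ 2 then (n : ℝ) ^ (-(2 * s.re)) else 0) := by
        gcongr
        exact sum_filter_rpow_le_tsum (by linarith) N

/-! ### The lemma -/

/-- **Discharge of `Conrad2005_lemma_3_1`** (Conrad 2005, Lemma 3.1). See the module docstring for
the proof. [cite: Conrad2005PartialEuler, Lemma 3.1] -/
theorem Conrad2005_lemma_3_1_holds : Conrad2005_lemma_3_1 := by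
  intro d α hα s hs
  -- everything only depends on `N = ⌊x⌋₊`
  have hred : ∀ x : ℝ, 0 ≤ x →
      logPartialProduct α s x - logPartialSum α s x -
        ∑ p ∈ (Nat.primesLE ⌊x⌋₊).filter (fun p : ℕ => Real.sqrt x < p),
          (∑ j, α p j ^ 2) / (2 * (p : ℂ) ^ (2 * s)) =
      logPartialProduct α s (⌊x⌋₊ : ℝ) - logPartialSum α s (⌊x⌋₊ : ℝ) -
        ∑ p ∈ (Nat.primesLE ⌊x⌋₊).filter (fun p => ⌊x⌋₊ < p ^ 2),
          (∑ j, (α p j * (p : ℂ) ^ (-s)) ^ 2) / (2 : ℕ) := by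
    intro x hx
    have h1 : logPartialProduct α s x = logPartialProduct α s (⌊x⌋₊ : ℝ) := logPartialProduct_eq_floor α s x
    have h2 : logPartialSum α s x = logPartialSum α s (⌊x⌋₊ : ℝ) := by
      rw [logPartialSum, logPartialSum, Nat.floor_natCast]
    have h3 : ∑ p ∈ (Nat.primesLE ⌊x⌋₊).filter (fun p : ℕ => Real.sqrt x < p),
          (∑ j, α p j ^ 2) / (2 * (p : ℂ) ^ (2 * s)) =
        ∑ p ∈ (Nat.primesLE ⌊x⌋₊).filter (fun p => ⌊x⌋₊ < p ^ 2),
          (∑ j, (α p j * (p : ℂ) ^ (-s)) ^ 2) / (2 : ℕ) := by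
      rw [Finset.filter_congr (fun p _ => sqrt_lt_iff_floor_lt_sq hx (p := p))]
      refine Finset.sum_congr rfl fun p hp => ?_
      rw [term_two_eq α (Nat.prime_of_mem_primesLE (Finset.mem_filter.mp hp).1)]
    rw [h1, h2, h3]
  have hmid : ∀ x : ℝ, 0 ≤ x →
      ∑ p ∈ (Nat.primesLE ⌊x⌋₊).filter (fun p : ℕ => Real.sqrt x < p),
          (∑ j, α p j ^ 2) / (2 * (p : ℂ) ^ (2 * s)) =
        ∑ p ∈ (Nat.primesLE ⌊x⌋₊).filter (fun p => ⌊x⌋₊ < p ^ 2),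
          (∑ j, (α p j * (p : ℂ) ^ (-s)) ^ 2) / (2 : ℕ) := by
    intro x hx
    rw [Finset.filter_congr (fun p _ => sqrt_lt_iff_floor_lt_sq hx (p := p))]
    refine Finset.sum_congr rfl fun p hp => ?_
    rw [term_two_eq α (Nat.prime_of_mem_primesLE (Finset.mem_filter.mp hp).1)]
  refine ⟨?_, fun hs' => ?_⟩
  · -- (i) `double - single - middle → 0`
    have hmaj : Tendsto (fun x : ℝ => 4 * d * (Real.log 4 / Real.log (⌊x⌋₊ : ℝ)) +
        2 * d * ∑' n : ℕ, (if n.Prime ∧ ⌊x⌋₊ < n ^ 2 then (n : ℝ) ^ (-(3 / 2 : ℝ)) else 0))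
        atTop (𝓝 0) := by
      have h1 : Tendsto (fun x : ℝ => Real.log 4 / Real.log (⌊x⌋₊ : ℝ)) atTop (𝓝 0) := by
        have := Real.tendsto_log_atTop.comp
          (tendsto_natCast_atTop_atTop.comp (tendsto_nat_floor_atTop (α := ℝ)))
        exact tendsto_const_nhds.div_atTop this
      have h2 := (tendsto_tsum_primes_sq_gt (3 / 2) (by norm_num)).comp (tendsto_nat_floor_atTop (α := ℝ))
      have := (h1.const_mul (4 * (d : ℝ))).add (h2.const_mul (2 * (d : ℝ)))
      simpa using this
    refine squeeze_zero_norm' ?_ hmaj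
    filter_upwards [eventually_ge_atTop (2 : ℝ)] with x hx
    have hx0 : 0 ≤ x := by linarith
    have hN2 : 2 ≤ ⌊x⌋₊ := Nat.le_floor (by simpa using hx)
    rw [hred x hx0]
    exact norm_sub_single_sub_middle_le hα hs hN2
  · -- (ii) `middle → 0` when `Re s > 1/2`
    have h2σ : 1 < 2 * s.re := by linarith
    have hM := (tendsto_tsum_primes_sq_gt (2 * s.re) h2σ).comp (tendsto_nat_floor_atTop (α := ℝ))
    refine squeeze_zero_norm' ?_ (by simpa using hM.const_mul (d : ℝ))
    filter_upwards [eventually_ge_atTop (0 : ℝ)] with x hx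
    rw [hmid x hx]
    exact norm_middle_le hα hs' ⌊x⌋₊

end PartialEuler

end Literature.NumberTheory.LFunctions

end
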